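import Summits.ValiantsHypothesis.ValiantsHypothesis.Theorems.KPlusLogSqLawTropicalBCyclePotentialOrderType
import Summits.ValiantsHypothesis.ValiantsHypothesis.Theorems.KPlusLogSqLawTropicalBCyclePotentialFour
import Summits.ValiantsHypothesis.ValiantsHypothesis.Theorems.KPlusLogSqLawTropicalBCyclePotentialAllK

/-!
# Route «KPlusLogSqLaw», crux `TropicalB` (stmt-ValiantsHypothesis-19771) — LONG STEPS ARE PAID BY THEIR SIZE:
# `n ≤ #J + H·(m + Σ_{k∈J} #{columns whose class changes at step k})`, `H = (2c+1)^K` (every design), `H = 9` at `K = 4, c = 2`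

HONEST FRAMING.  Helper toward the registered stubs `stub_tropThin` / `stub_tropFat` of `Cruxes/TropicalB/Lines/birth.lean` (crux
`Summit.ValiantsHypothesis.ValiantsHypothesis.Theses.KPlusLogSqLaw.TropicalB`, item stmt-ValiantsHypothesis-19771, route KPlusLogSqLaw; cell
`pub-symmetroid`, seat val-sym-trop-p1 g25, 2026-08-29; `--supports … --as helper`).  A STRUCTURE law for dominant chains of ARBITRARY designs; it does not
bound `TropicalB` in its window and bears on neither `WeakLifting`, DoorA26 / DoorA34, `MatrixDescartes` (stmt-ValiantsHypothesis-18050) nor VP ≠ VNP.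

The cycle potential law with RESETS (`CyclePotential.chain_le_resets`, p678718): for a `c`-compatible class potential `u ∈ [U₀, U₁]^K` and any set `J`
of steps outside which the exchange quotients have orbits `≤ c`, `n ≤ #J + m(U₁ − U₀) + Σ_{k∈J} (Φ(p_k) − Φ(p_{k+1}))`, `Φ(p) = Σ_b u(λ b)`.  The reset of a
step is carried by the columns whose CLASS changes, each contributing at most `U₁ − U₀`:

* `potential_drop_le_card_mul` — `Φ(p) − Φ(p') ≤ (U₁ − U₀)·#{b : λ b ≠ λ' b}`.
* `chain_le_mass` — hence **`n ≤ #J + (U₁ − U₀)·(m + Σ_{k∈J} #{b : class of b changes at step k})`** for every compatible `u`;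
  `chain_le_allK_mass` — with the exponent-free potential of `…TropicalBCyclePotentialAllK` (p684651): `n ≤ #J + (2c+1)^K·(m + Σ_{k∈J} #changed_k)` in
  EVERY design; `chain_le_four_mass` — at `K = 4`, `c = 2` with the kernel height `9` (p679675): `n ≤ #J + 9·(m + Σ_{k∈J} #changed_k)`.
* `chain_le_card_mul_of_bounded_steps` (general `u`), `chain_le_allK_card_mul` (`H = (2c+1)^K`), `chain_le_four_card_mul` (`K = 4`, `H = 9`) — if every
  step in `J` changes the class of at most `ℓ` columns then `n ≤ H·m + #J·(1 + H·ℓ)`: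
  long steps of BOUNDED size can only carry a chain in proportion to their NUMBER.  EXPONENT(4) reading (c = 2, H = 9): a cubic `(m, 4)` family whose
  exchange cycles have length `≤ ℓ` needs `#J ≥ (n − 9m)/(1 + 9ℓ)` steps with a `3⁺`-cycle — a constant FRACTION of all its steps, not merely `Ω(n/m)`
  (p679675's `(n+1)/(9m+1) − 1`); the quadratic GRW family escapes through its `m + 1` full rotations (cycle length `m`, linear resets).
With the tight / single-orbit normal form (p683233) `#changed_k ≤` the length of the ONE cycle of step `k`; so the chain length is controlled by the potential
height times `m +` the TOTAL COLUMN MASS OF THE LONG CYCLES.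
[this cell's law]
-/

set_option linter.dupNamespace false
set_option autoImplicit false

namespace Summit.ValiantsHypothesis.ValiantsHypothesis.Theorems.KPlusLogSqLaw

open Summit.ValiantsHypothesis.ValiantsHypothesis.Theorems.MatrixDescartes.Negative
open scoped BigOperators
open Finset

namespace CyclePotential

variable {m K : ℕ}

/-- **A reset is carried by the class-changing columns**: `Φ(λ₁) − Φ(λ₂) ≤ (U₁ − U₀)·#{b : λ₁ b ≠ λ₂ b}` for `u ∈ [U₀, U₁]`. [folklore] -/
theorem potential_drop_le_card_mul (u : Fin K → ℤ) (U₀ U₁ : ℤ) (hU : ∀ l, U₀ ≤ u l ∧ u l ≤ U₁) (l₁ l₂ : Fin m → Fin K) :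
    ∑ b, u (l₁ b) - ∑ b, u (l₂ b) ≤ (U₁ - U₀) * ((univ.filter fun b => l₁ b ≠ l₂ b).card : ℤ) := by
  classical
  rw [← sum_sub_distrib]
  have hsplit := (sum_filter_add_sum_filter_not univ (fun b => l₁ b ≠ l₂ b) (fun b => u (l₁ b) - u (l₂ b))).symm
  rw [hsplit]
  have h0 : ∑ b ∈ univ.filter (fun b => ¬ l₁ b ≠ l₂ b), (u (l₁ b) - u (l₂ b)) = 0 := by
    refine sum_eq_zero fun b hb => ?_
    have : l₁ b = l₂ b := not_not.mp (mem_filter.mp hb).2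
    rw [this, sub_self]
  rw [h0, add_zero]
  calc ∑ b ∈ univ.filter (fun b => l₁ b ≠ l₂ b), (u (l₁ b) - u (l₂ b))
      ≤ ∑ _b ∈ univ.filter (fun b => l₁ b ≠ l₂ b), (U₁ - U₀) :=
        sum_le_sum fun b _ => by linarith [(hU (l₁ b)).2, (hU (l₂ b)).1]
    _ = (U₁ - U₀) * ((univ.filter fun b => l₁ b ≠ l₂ b).card : ℤ) := by rw [sum_const, nsmul_eq_mul, mul_comm]

variable (d : Fin K → ℕ) (v ε : Fin m → Fin m → Fin K → ℤ)

/-- **CYCLE POTENTIAL LAW WITH COLUMN MASS.**  For a `c`-compatible class potential `u ∈ [U₀, U₁]^K` and any set `J` of steps outside which the exchange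
quotients have orbits `≤ c`: `n ≤ #J + (U₁ − U₀)·(m + Σ_{k∈J} #{b : the class of column b changes at step k})`. [this cell's law] -/
theorem chain_le_mass (c : ℕ) (u : Fin K → ℤ)
    (hu : ∀ B : Finset (Fin m), B.card ≤ c → ∀ f g : Fin m → Fin K,
      ∑ b ∈ B, (d (f b) : ℤ) < ∑ b ∈ B, (d (g b) : ℤ) → ∑ b ∈ B, u (f b) < ∑ b ∈ B, u (g b))
    (U₀ U₁ : ℤ) (hU : ∀ l, U₀ ≤ u l ∧ u l ≤ U₁)
    {n : ℕ} (θ : Fin (n + 1) → ℤ) (p : Fin (n + 1) → Equiv.Perm (Fin m) × (Fin m → Fin K))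
    (hθ : StrictMono θ) (hdom : ∀ k, IsDominant d v ε (θ k) (p k)) (hne : ∀ k : Fin n, p k.castSucc ≠ p k.succ)
    (J : Finset (Fin n))
    (horb : ∀ k : Fin n, k ∉ J → ∀ b : Fin m, ∃ T : Finset (Fin m), b ∈ T ∧ T.card ≤ c ∧
      ∀ x, ((p k.castSucc).1⁻¹ * (p k.succ).1) x ∈ T ↔ x ∈ T) :
    (n : ℤ) ≤ J.card + (U₁ - U₀) * (m + ∑ k ∈ J, ((univ.filter fun b => (p k.castSucc).2 b ≠ (p k.succ).2 b).card : ℤ)) := by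
  classical
  have h := chain_le_resets d v ε c u hu U₀ U₁ hU θ p hθ hdom hne J horb
  have hsum : ∑ k ∈ J, (∑ b, u ((p k.castSucc).2 b) - ∑ b, u ((p k.succ).2 b)) ≤
      ∑ k ∈ J, (U₁ - U₀) * ((univ.filter fun b => (p k.castSucc).2 b ≠ (p k.succ).2 b).card : ℤ) :=
    sum_le_sum fun k _ => potential_drop_le_card_mul u U₀ U₁ hU _ _
  rw [← mul_sum] at hsum
  linarith

/-- **Bounded long steps are paid by their number**: if moreover every step in `J` changes the class of at most `ℓ` columns, then
`n ≤ (U₁ − U₀)·m + #J·(1 + (U₁ − U₀)·ℓ)`. [this cell's law] -/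
theorem chain_le_card_mul_of_bounded_steps (c : ℕ) (u : Fin K → ℤ)
    (hu : ∀ B : Finset (Fin m), B.card ≤ c → ∀ f g : Fin m → Fin K,
      ∑ b ∈ B, (d (f b) : ℤ) < ∑ b ∈ B, (d (g b) : ℤ) → ∑ b ∈ B, u (f b) < ∑ b ∈ B, u (g b))
    (U₀ U₁ : ℤ) (hU : ∀ l, U₀ ≤ u l ∧ u l ≤ U₁)
    {n : ℕ} (θ : Fin (n + 1) → ℤ) (p : Fin (n + 1) → Equiv.Perm (Fin m) × (Fin m → Fin K))
    (hθ : StrictMono θ) (hdom : ∀ k, IsDominant d v ε (θ k) (p k)) (hne : ∀ k : Fin n, p k.castSucc ≠ p k.succ)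
    (J : Finset (Fin n))
    (horb : ∀ k : Fin n, k ∉ J → ∀ b : Fin m, ∃ T : Finset (Fin m), b ∈ T ∧ T.card ≤ c ∧
      ∀ x, ((p k.castSucc).1⁻¹ * (p k.succ).1) x ∈ T ↔ x ∈ T)
    (ℓ : ℕ) (hℓ : ∀ k ∈ J, (univ.filter fun b => (p k.castSucc).2 b ≠ (p k.succ).2 b).card ≤ ℓ) :
    (n : ℤ) ≤ (U₁ - U₀) * m + J.card * (1 + (U₁ - U₀) * ℓ) := by
  classical
  have h := chain_le_mass d v ε c u hu U₀ U₁ hU θ p hθ hdom hne J horb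
  have hsum : ∑ k ∈ J, ((univ.filter fun b => (p k.castSucc).2 b ≠ (p k.succ).2 b).card : ℤ) ≤ J.card * ℓ := by
    calc ∑ k ∈ J, ((univ.filter fun b => (p k.castSucc).2 b ≠ (p k.succ).2 b).card : ℤ) ≤ ∑ _k ∈ J, (ℓ : ℤ) :=
          sum_le_sum fun k hk => by exact_mod_cast hℓ k hk
      _ = J.card * ℓ := by rw [sum_const, nsmul_eq_mul]
  rcases Nat.eq_zero_or_pos K with hK | hK
  · -- no classes: then no columns, one term, `n = 0`, `J = ∅`
    subst hK
    have hm : m = 0 := by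
      rcases Nat.eq_zero_or_pos m with hm | hm
      · exact hm
      · exact absurd ((p 0).2 ⟨0, hm⟩).isLt (Nat.not_lt_zero _)
    subst hm
    have hn : n = 0 := by
      rcases Nat.eq_zero_or_pos n with hn | hn
      · exact hn
      · exfalso
        exact hne ⟨0, hn⟩ (Prod.ext (Equiv.ext fun b => b.elim0) (funext fun b => b.elim0))
    subst hn
    have hJ : J = ∅ := eq_empty_of_isEmpty J
    simp [hJ]
  · have hH : 0 ≤ U₁ - U₀ := by have := hU ⟨0, hK⟩; linarith
    nlinarith

/-- **Column-mass law, every design** (`H = (2c+1)^K` from `exists_compatible_allK`):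
`n ≤ #J + (2c+1)^K·(m + Σ_{k∈J} #{b : class of b changes at step k})`. [this cell's law] -/
theorem chain_le_allK_mass (c : ℕ) {n : ℕ} (θ : Fin (n + 1) → ℤ) (p : Fin (n + 1) → Equiv.Perm (Fin m) × (Fin m → Fin K))
    (hθ : StrictMono θ) (hdom : ∀ k, IsDominant d v ε (θ k) (p k)) (hne : ∀ k : Fin n, p k.castSucc ≠ p k.succ)
    (J : Finset (Fin n))
    (horb : ∀ k : Fin n, k ∉ J → ∀ b : Fin m, ∃ T : Finset (Fin m), b ∈ T ∧ T.card ≤ c ∧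
      ∀ x, ((p k.castSucc).1⁻¹ * (p k.succ).1) x ∈ T ↔ x ∈ T) :
    (n : ℤ) ≤ J.card + (((2 * c + 1) ^ K : ℕ) : ℤ) * (m + ∑ k ∈ J, ((univ.filter fun b => (p k.castSucc).2 b ≠ (p k.succ).2 b).card : ℤ)) := by
  obtain ⟨u, hU, hu⟩ := exists_compatible_allK (m := m) c d
  have h := chain_le_mass d v ε c u hu 0 (((2 * c + 1) ^ K : ℕ) : ℤ) hU θ p hθ hdom hne J horb
  rw [sub_zero] at h
  exact h

/-- **Column-mass law, every design, bounded long steps**: steps in `J` changing the class of `≤ ℓ` columns ⇒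
`n ≤ (2c+1)^K·m + #J·(1 + (2c+1)^K·ℓ)`. [this cell's law] -/
theorem chain_le_allK_card_mul (c : ℕ) {n : ℕ} (θ : Fin (n + 1) → ℤ) (p : Fin (n + 1) → Equiv.Perm (Fin m) × (Fin m → Fin K))
    (hθ : StrictMono θ) (hdom : ∀ k, IsDominant d v ε (θ k) (p k)) (hne : ∀ k : Fin n, p k.castSucc ≠ p k.succ)
    (J : Finset (Fin n))
    (horb : ∀ k : Fin n, k ∉ J → ∀ b : Fin m, ∃ T : Finset (Fin m), b ∈ T ∧ T.card ≤ c ∧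
      ∀ x, ((p k.castSucc).1⁻¹ * (p k.succ).1) x ∈ T ↔ x ∈ T)
    (ℓ : ℕ) (hℓ : ∀ k ∈ J, (univ.filter fun b => (p k.castSucc).2 b ≠ (p k.succ).2 b).card ≤ ℓ) :
    (n : ℤ) ≤ (((2 * c + 1) ^ K : ℕ) : ℤ) * m + J.card * (1 + (((2 * c + 1) ^ K : ℕ) : ℤ) * ℓ) := by
  obtain ⟨u, hU, hu⟩ := exists_compatible_allK (m := m) c d
  have h := chain_le_card_mul_of_bounded_steps d v ε c u hu 0 (((2 * c + 1) ^ K : ℕ) : ℤ) hU θ p hθ hdom hne J horb ℓ hℓ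
  rw [sub_zero] at h
  exact h

end CyclePotential

namespace CyclePotential

variable {m : ℕ} (d : Fin 4 → ℕ) (v ε : Fin m → Fin m → Fin 4 → ℤ)

/-- **Column-mass law at `K = 4`, `c = 2`** (kernel height `9`, p679675): steps in `J` ⊇ the steps with a `3⁺`-cycle ⇒
`n ≤ #J + 9·(m + Σ_{k∈J} #{b : class of b changes at step k})`. [this cell's law] -/
theorem chain_le_four_mass {n : ℕ} (θ : Fin (n + 1) → ℤ) (p : Fin (n + 1) → Equiv.Perm (Fin m) × (Fin m → Fin 4))
    (hθ : StrictMono θ) (hdom : ∀ k, IsDominant d v ε (θ k) (p k)) (hne : ∀ k : Fin n, p k.castSucc ≠ p k.succ)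
    (J : Finset (Fin n))
    (horb : ∀ k : Fin n, k ∉ J → ∀ b : Fin m, ∃ T : Finset (Fin m), b ∈ T ∧ T.card ≤ 2 ∧
      ∀ x, ((p k.castSucc).1⁻¹ * (p k.succ).1) x ∈ T ↔ x ∈ T) :
    (n : ℤ) ≤ J.card + 9 * (m + ∑ k ∈ J, ((univ.filter fun b => (p k.castSucc).2 b ≠ (p k.succ).2 b).card : ℤ)) := by
  obtain ⟨u, hU, hu⟩ := exists_twoCompatible_four (m := m) d
  have h := chain_le_mass d v ε 2 u hu 0 9 hU θ p hθ hdom hne J horb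
  rw [sub_zero] at h
  exact h

/-- **`K = 4`: long steps of bounded size are a constant fraction** — steps in `J` ⊇ the `3⁺`-cycle steps, each changing the class of `≤ ℓ` columns ⇒
`n ≤ 9m + #J·(1 + 9ℓ)`, i.e. `#J ≥ (n − 9m)/(1 + 9ℓ)`. [this cell's law] -/
theorem chain_le_four_card_mul {n : ℕ} (θ : Fin (n + 1) → ℤ) (p : Fin (n + 1) → Equiv.Perm (Fin m) × (Fin m → Fin 4))
    (hθ : StrictMono θ) (hdom : ∀ k, IsDominant d v ε (θ k) (p k)) (hne : ∀ k : Fin n, p k.castSucc ≠ p k.succ)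
    (J : Finset (Fin n))
    (horb : ∀ k : Fin n, k ∉ J → ∀ b : Fin m, ∃ T : Finset (Fin m), b ∈ T ∧ T.card ≤ 2 ∧
      ∀ x, ((p k.castSucc).1⁻¹ * (p k.succ).1) x ∈ T ↔ x ∈ T)
    (ℓ : ℕ) (hℓ : ∀ k ∈ J, (univ.filter fun b => (p k.castSucc).2 b ≠ (p k.succ).2 b).card ≤ ℓ) :
    (n : ℤ) ≤ 9 * m + J.card * (1 + 9 * ℓ) := by
  obtain ⟨u, hU, hu⟩ := exists_twoCompatible_four (m := m) d
  have h := chain_le_card_mul_of_bounded_steps d v ε 2 u hu 0 9 hU θ p hθ hdom hne J horb ℓ hℓ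
  rw [sub_zero] at h
  exact h

end CyclePotential

end Summit.ValiantsHypothesis.ValiantsHypothesis.Theorems.KPlusLogSqLaw
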